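import Mathlib
import Summits.MatrixMultiplication.MatrixMultiplication.Theorems.SnSubsetDichotomyPolynomialSlackPinningNormalized
import Summits.MatrixMultiplication.MatrixMultiplication.Theorems.SnSubsetDichotomyPolynomialSlackKeptTerm
import Summits.MatrixMultiplication.MatrixMultiplication.Theorems.SnSubsetDichotomyPolynomialSlackPairParseval
import Summits.MatrixMultiplication.MatrixMultiplication.Theorems.SnSubsetDichotomyPolynomialSlackPairLightEnergy
import Summits.MatrixMultiplication.MatrixMultiplication.Theorems.SnSubsetDichotomyPolynomialSlackStubSplit
import Summits.MatrixMultiplication.MatrixMultiplication.Theorems.SnSubsetDichotomyPolynomialSlackMarginals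

/-!
# No dense quotient: the error budget of the split pinning is already spent

Crux `Summit.MatrixMultiplication.MatrixMultiplication.Theses.SnSubsetDichotomy.PolynomialSlack`
(item `stmt-MatrixMultiplication-8306`), level-one programme, line transport-split-hull (lead c6,
"beyond one half"), the case of NO dense quotient. For a parity-pure TPP triple `S, T, U ⊆ S_n`
(`n ≥ 40`, `N = |S||T||U|`) all three quotients `A = S⁻¹T`, `B = T⁻¹U`, `C = U⁻¹S` are assumed
non-dense: `K_X = n!/|pair| ≥ 16M`. Each centred profile `d_X - 1/n` (`d_A = m_{ST}/(|S||T|)`, …) is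
split at the threshold `θ_X = K_X/(nM) ≥ 16/n` into a nonnegative HEAVY part
`p_X = (d_X - 1/n)·[θ_X ≤ d_X]` and a LIGHT part `l_X = (d_X - 1/n)·[d_X < θ_X]`, with
`Σ p_X² ≤ Σ (d_X - 1/n)² ≤ E_X := K_X/(n-1)` (`pair_parseval`) and `Σ l_X² ≤ γ'·E_X`,
`γ' = 100(1 + log n)L/M` (`pair_light_energy`). The kept-term pinning `kept_ge_of_split` then reads
`1 - δ₀ - 3(n-1)√γ'√(E_A E_B E_C) ≤ -(n-1)·Σ p_A p_B p_C ≤ 0`, and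
`(n-1)√(E_A E_B E_C) = F/√(n-1)` with `F = n!√(n!)/N` (`K_A K_B K_C = F²`):

* `one_le_error_of_split_ABC` — `1 ≤ δ₀ + 3√γ'·F/√(n-1)`,
  `δ₀ = n!/(2N) + n!√(n!)/(2N√(n(n-1)/6))`.
-/

namespace Summit.MatrixMultiplication.MatrixMultiplication.Theorems.PolynomialSlack

open scoped BigOperators
open Literature.Combinatorics.Additive (TripleProductProperty)

-- `Summit.<Summit>.<Problem>` is the tree's mandated summit-side namespace (CONVENTIONS §2); for
-- this single-conjunct summit the two coincide, so each declaration silences `dupNamespace`.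
set_option linter.dupNamespace false

/-- **Heavy/light split of one non-dense pair profile.** For non-empty `X, Y ⊆ S_n` (`n ≥ 40`) with
`(x,y) ↦ x⁻¹y` injective on `X × Y`, profile `d = m_{XY}/(|X||Y|)`, co-density
`K = n!/(|X||Y|) ≥ 16M` (`M ≥ 1`) and `log(4n·n!/(|X||Y|)) ≤ L` (`L ≥ 1`), the threshold
`θ = K/(nM) ≥ 1/n` splits `d - 1/n = p + l` into the heavy part `p = (d - 1/n)·[θ ≤ d] ≥ 0` and the
light part `l`, with `Σ (d - 1/n)² ≤ K/(n-1)`, `Σ p² ≤ K/(n-1)` (`pair_parseval`) and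
`Σ l² ≤ (100(1 + log n)L/M)·K/(n-1)` (`pair_light_energy`). [folklore] -/
private theorem pair_split_facts {n : ℕ} (hn : 40 ≤ n) (X Y : Finset (Equiv.Perm (Fin n)))
    (hX : X.Nonempty) (hY : Y.Nonempty)
    (hinj : Set.InjOn (fun xy : Equiv.Perm (Fin n) × Equiv.Perm (Fin n) => xy.1⁻¹ * xy.2)
      (↑X ×ˢ ↑Y : Set (Equiv.Perm (Fin n) × Equiv.Perm (Fin n))))
    (d : Fin n → Fin n → ℝ)
    (hd : ∀ i j, d i j =
      (((X ×ˢ Y).filter fun xy => xy.2 j = xy.1 i).card : ℝ) / (X.card * Y.card : ℕ))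
    (M L : ℝ) (hM : 1 ≤ M) (hL : 1 ≤ L)
    (hK : 16 * M ≤ (n.factorial : ℝ) / (X.card * Y.card : ℕ))
    (hLX : Real.log (4 * n * n.factorial / (X.card * Y.card : ℕ)) ≤ L) :
    ∃ p l : Fin n → Fin n → ℝ,
      (∀ i j, d i j - 1 / n = p i j + l i j) ∧ (∀ i j, 0 ≤ p i j) ∧
      (∑ i : Fin n, ∑ j : Fin n, (d i j - 1 / n) ^ 2 ≤
          (n.factorial : ℝ) / (X.card * Y.card : ℕ) / ((n : ℝ) - 1)) ∧
      (∑ i : Fin n, ∑ j : Fin n, p i j ^ 2 ≤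
          (n.factorial : ℝ) / (X.card * Y.card : ℕ) / ((n : ℝ) - 1)) ∧
      (∑ i : Fin n, ∑ j : Fin n, l i j ^ 2 ≤ 100 * (1 + Real.log n) * L / M *
          ((n.factorial : ℝ) / (X.card * Y.card : ℕ) / ((n : ℝ) - 1))) := by
  -- Parseval and the restricted level-one inequality for this pair
  have hpar := pair_parseval hn X Y hX hY hinj d hd
  set K : ℝ := (n.factorial : ℝ) / (X.card * Y.card : ℕ) with hKdef
  have hK0 : 0 ≤ K := by rw [hKdef]; positivity
  have hnR : (40 : ℝ) ≤ n := by exact_mod_cast hn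
  have hn1 : 1 ≤ n := by omega
  have hn0 : (0 : ℝ) < n := by linarith
  have hn0' : (n : ℝ) ≠ 0 := hn0.ne'
  have hm0 : (0 : ℝ) < (n : ℝ) - 1 := by linarith
  have hM0 : (0 : ℝ) < M := by linarith
  have hM0' : M ≠ 0 := hM0.ne'
  have hL0 : (0 : ℝ) ≤ L := by linarith
  have hKM : (16 : ℝ) ≤ K / M := by rw [le_div_iff₀ hM0]; exact hK
  have hlog : 0 ≤ Real.log (n : ℝ) := Real.log_nonneg (by linarith)
  -- the threshold `θ = K/(nM) ≥ 16/n ≥ 1/n`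
  set θ : ℝ := K / M / n with hθ
  have hnθ : (n : ℝ) * θ = K / M := by rw [hθ]; field_simp
  have hθ1 : 1 / (n : ℝ) ≤ θ := by
    rw [hθ]; exact div_le_div_of_nonneg_right (by linarith) hn0.le
  have hlight := pair_light_energy hn1 X Y hX hY hinj d hd θ hθ1
  have hsq : ∑ i : Fin n, ∑ j : Fin n, (d i j - 1 / n) ^ 2 ≤ K / ((n : ℝ) - 1) := by
    rw [le_div_iff₀ hm0]; linarith [hpar]
  refine ⟨fun i j => if θ ≤ d i j then d i j - 1 / n else 0,
    fun i j => if θ ≤ d i j then 0 else d i j - 1 / n, ?_, ?_, hsq, ?_, ?_⟩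
  · intro i j
    by_cases h : θ ≤ d i j
    · simp only [if_pos h, add_zero]
    · simp only [if_neg h, zero_add]
  · intro i j
    by_cases h : θ ≤ d i j
    · simp only [if_pos h]; linarith [hθ1]
    · simp only [if_neg h]; exact le_rfl
  · calc ∑ i : Fin n, ∑ j : Fin n, (if θ ≤ d i j then d i j - 1 / n else 0) ^ 2
        ≤ ∑ i : Fin n, ∑ j : Fin n, (d i j - 1 / n) ^ 2 := by
          refine Finset.sum_le_sum fun i _ => Finset.sum_le_sum fun j _ => ?_
          by_cases h : θ ≤ d i j
          · simp only [if_pos h]; exact le_rfl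
          · simp only [if_neg h]; nlinarith [sq_nonneg (d i j - 1 / n)]
      _ ≤ K / ((n : ℝ) - 1) := hsq
  · have hc0 : 0 ≤ 100 * (1 + Real.log n) * (K / M) :=
      mul_nonneg (mul_nonneg (by norm_num) (by linarith)) (div_nonneg hK0 hM0.le)
    calc ∑ i : Fin n, ∑ j : Fin n, (if θ ≤ d i j then 0 else d i j - 1 / n) ^ 2
        ≤ 100 * (1 + Real.log n) * ((n : ℝ) * θ) *
            Real.log (4 * n * n.factorial / (X.card * Y.card : ℕ)) / n := hlight
      _ = 100 * (1 + Real.log n) * (K / M) *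
            Real.log (4 * n * n.factorial / (X.card * Y.card : ℕ)) / n := by rw [hnθ]
      _ ≤ 100 * (1 + Real.log n) * (K / M) * L / n :=
          div_le_div_of_nonneg_right (mul_le_mul_of_nonneg_left hLX hc0) hn0.le
      _ ≤ 100 * (1 + Real.log n) * (K / M) * L / ((n : ℝ) - 1) :=
          div_le_div_of_nonneg_left (mul_nonneg hc0 hL0) hm0 (by linarith)
      _ = 100 * (1 + Real.log n) * L / M * (K / ((n : ℝ) - 1)) := by ring

set_option maxHeartbeats 1600000 in
/-- **No dense quotient: the error budget is spent.** For `n ≥ 40` and a parity-pure TPP triple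
`S, T, U ⊆ S_n` of non-empty sets with `N = |S||T||U|`, if all three quotients are non-dense
(`16M ≤ n!/(|S||T|), n!/(|T||U|), n!/(|U||S|)`, `M ≥ 1`) and `log(4n·n!/|pair|) ≤ L` (`L ≥ 1`) for the
three pairs, then
`1 ≤ n!/(2N) + n!√(n!)/(2N√(n(n-1)/6)) + 3√(100(1+log n)L/M)·(n!√(n!)/N)/√(n-1)`.
Proof: split each centred profile into heavy and light parts (`pair_split_facts`), feed the
normalised pinning `pinning_normalized` to `kept_ge_of_split`; the kept term `-(n-1)Σ p_A p_B p_C`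
is `≤ 0` since every heavy part is `≥ 0`, and `(n-1)√(E_A E_B E_C) = n!√(n!)/(N√(n-1))` because
`|S||T|·|T||U|·|U||S| = N²`. [folklore] -/
theorem one_le_error_of_split_ABC {n : ℕ} (hn : 40 ≤ n) {S T U : Finset (Equiv.Perm (Fin n))}
    (hTPP : TripleProductProperty S T U) (hS0 : S.Nonempty) (hT0 : T.Nonempty) (hU0 : U.Nonempty)
    (hS : ∀ s ∈ S, ∀ s' ∈ S, Equiv.Perm.sign s = Equiv.Perm.sign s')
    (hT : ∀ t ∈ T, ∀ t' ∈ T, Equiv.Perm.sign t = Equiv.Perm.sign t')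
    (hU : ∀ u ∈ U, ∀ u' ∈ U, Equiv.Perm.sign u = Equiv.Perm.sign u')
    (M L : ℝ) (hM : 1 ≤ M) (hL : 1 ≤ L)
    (hKA : 16 * M ≤ (n.factorial : ℝ) / (S.card * T.card : ℕ))
    (hKB : 16 * M ≤ (n.factorial : ℝ) / (T.card * U.card : ℕ))
    (hKC : 16 * M ≤ (n.factorial : ℝ) / (U.card * S.card : ℕ))
    (hLA : Real.log (4 * n * n.factorial / (S.card * T.card : ℕ)) ≤ L)
    (hLB : Real.log (4 * n * n.factorial / (T.card * U.card : ℕ)) ≤ L)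
    (hLC : Real.log (4 * n * n.factorial / (U.card * S.card : ℕ)) ≤ L) :
    1 ≤ (n.factorial : ℝ) / (2 * (S.card * T.card * U.card : ℕ)) +
          (n.factorial : ℝ) * Real.sqrt (n.factorial : ℝ) /
            (2 * (S.card * T.card * U.card : ℕ) * Real.sqrt (((n * (n - 1) : ℕ) : ℝ) / 6)) +
          3 * Real.sqrt (100 * (1 + Real.log n) * L / M) *
            ((n.factorial : ℝ) * Real.sqrt (n.factorial : ℝ) / (S.card * T.card * U.card : ℕ)) /
              Real.sqrt ((n : ℝ) - 1) := by
  -- the three quotient profiles, as opaque arrays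
  obtain ⟨dA, hdA⟩ : ∃ dA : Fin n → Fin n → ℝ, ∀ i j, dA i j =
      (((S ×ˢ T).filter fun st => st.2 j = st.1 i).card : ℝ) / (S.card * T.card : ℕ) :=
    ⟨_, fun _ _ => rfl⟩
  obtain ⟨dB, hdB⟩ : ∃ dB : Fin n → Fin n → ℝ, ∀ j k, dB j k =
      (((T ×ˢ U).filter fun tu => tu.2 k = tu.1 j).card : ℝ) / (T.card * U.card : ℕ) :=
    ⟨_, fun _ _ => rfl⟩
  obtain ⟨dC, hdC⟩ : ∃ dC : Fin n → Fin n → ℝ, ∀ k i, dC k i =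
      (((U ×ˢ S).filter fun us => us.2 i = us.1 k).card : ℝ) / (U.card * S.card : ℕ) :=
    ⟨_, fun _ _ => rfl⟩
  -- the normalised pinning in terms of the profiles
  have hpin : 1 - (n.factorial : ℝ) / (2 * (S.card * T.card * U.card : ℕ)) -
      (n.factorial : ℝ) * Real.sqrt (n.factorial : ℝ) /
        (2 * (S.card * T.card * U.card : ℕ) * Real.sqrt (((n * (n - 1) : ℕ) : ℝ) / 6)) ≤
      -((n : ℝ) - 1) * ∑ i : Fin n, ∑ j : Fin n, ∑ k : Fin n,
        (dA i j - 1 / n) * (dB j k - 1 / n) * (dC k i - 1 / n) := by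
    simp only [hdA, hdB, hdC]
    exact pinning_normalized n hn S T U hTPP hS0 hT0 hU0 hS hT hU
  -- heavy/light splits of the three profiles
  obtain ⟨pA, lA, hA1, hA2, -, hA4, hA5⟩ :=
    pair_split_facts hn S T hS0 hT0 (injOn_quot_first hTPP hU0) dA hdA M L hM hL hKA hLA
  obtain ⟨pB, lB, hB1, hB2, hB3, hB4, hB5⟩ :=
    pair_split_facts hn T U hT0 hU0 (injOn_quot_second hTPP hS0) dB hdB M L hM hL hKB hLB
  obtain ⟨pC, lC, hC1, hC2, hC3, hC4, hC5⟩ :=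
    pair_split_facts hn U S hU0 hS0 (injOn_quot_first hTPP.rotate.rotate hT0) dC hdC M L hM hL
      hKC hLC
  clear hdA hdB hdC hKA hKB hKC hLA hLB hLC
  -- scalar bookkeeping
  have hnR : (40 : ℝ) ≤ n := by exact_mod_cast hn
  have hn1 : (1 : ℝ) ≤ n := by linarith
  have hm0 : (0 : ℝ) < (n : ℝ) - 1 := by linarith
  have hM0 : (0 : ℝ) < M := by linarith
  have hlog : 0 ≤ Real.log (n : ℝ) := Real.log_nonneg hn1
  have hN0 : (0 : ℝ) < ((S.card * T.card * U.card : ℕ) : ℝ) := by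
    exact_mod_cast Nat.mul_pos (Nat.mul_pos hS0.card_pos hT0.card_pos) hU0.card_pos
  have hα0 : (0 : ℝ) < ((S.card * T.card : ℕ) : ℝ) := by
    exact_mod_cast Nat.mul_pos hS0.card_pos hT0.card_pos
  have hβ0 : (0 : ℝ) < ((T.card * U.card : ℕ) : ℝ) := by
    exact_mod_cast Nat.mul_pos hT0.card_pos hU0.card_pos
  have hγ0 : (0 : ℝ) < ((U.card * S.card : ℕ) : ℝ) := by
    exact_mod_cast Nat.mul_pos hU0.card_pos hS0.card_pos
  have hαβγ : ((S.card * T.card : ℕ) : ℝ) * ((T.card * U.card : ℕ) : ℝ) * ((U.card * S.card : ℕ) : ℝ) =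
      ((S.card * T.card * U.card : ℕ) : ℝ) ^ 2 := by
    push_cast; ring
  have hf0 : (0 : ℝ) < (n.factorial : ℝ) := by exact_mod_cast n.factorial_pos
  set N : ℝ := ((S.card * T.card * U.card : ℕ) : ℝ)
  set α : ℝ := ((S.card * T.card : ℕ) : ℝ)
  set β : ℝ := ((T.card * U.card : ℕ) : ℝ)
  set γ : ℝ := ((U.card * S.card : ℕ) : ℝ)
  set f : ℝ := (n.factorial : ℝ)
  set D : ℝ := Real.sqrt (((n * (n - 1) : ℕ) : ℝ) / 6)
  set g : ℝ := 100 * (1 + Real.log n) * L / M with hg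
  have hg0 : 0 ≤ g := by
    rw [hg]; exact div_nonneg (mul_nonneg (mul_nonneg (by norm_num) (by linarith)) (by linarith)) hM0.le
  clear_value N α β γ f D g
  have hNne : N ≠ 0 := hN0.ne'
  have hmne : (n : ℝ) - 1 ≠ 0 := hm0.ne'
  have hsm0 : 0 < Real.sqrt ((n : ℝ) - 1) := Real.sqrt_pos.2 hm0
  have hsmne : Real.sqrt ((n : ℝ) - 1) ≠ 0 := hsm0.ne'
  have hEA : 0 ≤ f / α / ((n : ℝ) - 1) := div_nonneg (div_nonneg hf0.le hα0.le) hm0.le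
  have hEB : 0 ≤ f / β / ((n : ℝ) - 1) := div_nonneg (div_nonneg hf0.le hβ0.le) hm0.le
  have hEC : 0 ≤ f / γ / ((n : ℝ) - 1) := div_nonneg (div_nonneg hf0.le hγ0.le) hm0.le
  -- the kept-term pinning
  have hkept := kept_ge_of_split (fun i j => dA i j - 1 / n) (fun j k => dB j k - 1 / n)
    (fun k i => dC k i - 1 / n) pA lA pB lB pC lC hA1 hB1 hC1 hn1
    (f / α / ((n : ℝ) - 1)) (f / β / ((n : ℝ) - 1)) (f / γ / ((n : ℝ) - 1)) g
    (f / (2 * N) + f * Real.sqrt f / (2 * N * D)) hEA hEB hEC hg0 hB3 hC3 hA4 hB4 hA5 hB5 hC5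
    (by rw [← sub_sub]; exact hpin)
  -- the kept term is nonpositive
  have hsum : 0 ≤ ∑ i : Fin n, ∑ j : Fin n, ∑ k : Fin n, pA i j * pB j k * pC k i :=
    Finset.sum_nonneg fun i _ => Finset.sum_nonneg fun j _ => Finset.sum_nonneg fun k _ =>
      mul_nonneg (mul_nonneg (hA2 i j) (hB2 j k)) (hC2 k i)
  have hmS : 0 ≤ ((n : ℝ) - 1) * ∑ i : Fin n, ∑ j : Fin n, ∑ k : Fin n, pA i j * pB j k * pC k i :=
    mul_nonneg hm0.le hsum
  -- `E_A E_B E_C = (f/N/(n-1))² · f/(n-1)`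
  have hE : f / α / ((n : ℝ) - 1) * (f / β / ((n : ℝ) - 1)) * (f / γ / ((n : ℝ) - 1)) =
      (f / N / ((n : ℝ) - 1)) ^ 2 * (f / ((n : ℝ) - 1)) := by
    calc f / α / ((n : ℝ) - 1) * (f / β / ((n : ℝ) - 1)) * (f / γ / ((n : ℝ) - 1))
        = (f / ((n : ℝ) - 1)) ^ 3 * (α * β * γ)⁻¹ := by ring
      _ = (f / ((n : ℝ) - 1)) ^ 3 * (N ^ 2)⁻¹ := by rw [hαβγ]
      _ = (f / N / ((n : ℝ) - 1)) ^ 2 * (f / ((n : ℝ) - 1)) := by ring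
  have hsq : Real.sqrt (f / α / ((n : ℝ) - 1) * (f / β / ((n : ℝ) - 1)) * (f / γ / ((n : ℝ) - 1))) =
      f / N / ((n : ℝ) - 1) * (Real.sqrt f / Real.sqrt ((n : ℝ) - 1)) := by
    rw [hE, Real.sqrt_mul (sq_nonneg _), Real.sqrt_sq (div_nonneg (div_nonneg hf0.le hN0.le) hm0.le),
      Real.sqrt_div' _ hm0.le]
  have hfin : 3 * ((n : ℝ) - 1) * Real.sqrt g *
      Real.sqrt (f / α / ((n : ℝ) - 1) * (f / β / ((n : ℝ) - 1)) * (f / γ / ((n : ℝ) - 1))) =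
      3 * Real.sqrt g * (f * Real.sqrt f / N) / Real.sqrt ((n : ℝ) - 1) := by
    rw [hsq]
    field_simp
  rw [hfin] at hkept
  linarith [hkept, hmS]

end Summit.MatrixMultiplication.MatrixMultiplication.Theorems.PolynomialSlack
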